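import Summits.ValiantsHypothesis.ValiantsHypothesis.Theses.DivisionGap
import Literature.Computability.AlgebraicComplexity.StandardFamiliesProofs
import Summits.ValiantsHypothesis.ValiantsHypothesis.Theorems.PerCofactorDegreeReduction.Negative.KillCost
import Summits.ValiantsHypothesis.ValiantsHypothesis.Theorems.DivisionGapPerCofactorDegreeReductionStubBottomComponentFree

/-!
# Crux `DivisionGap.PerCofactorDegreeReduction` (stmt-ValiantsHypothesis-15046), line `Sketch` —
# the WINDOW of the crux, part 1: glue (arithmetic of the quasi-polynomial bound, the free bottom slice)

The crux reads `∃ k, ∀ n, ∀ h ≠ 0, ∃ h' ≠ 0, deg h' ≤ B ∧ L(per_n · h') ≤ B` with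
`B = 2 ^ ((log₂ n + log₂ L(per_n · h) + k) ^ k)`, `L = complexity` over `ℝ≥0` (monotone circuits).
This file collects the sorry-free glue used by `…Window.lean` to show that the crux is equivalent
to its restriction to a WINDOW of cofactors (single-typed, content-free, sub-exponential regime,
high degree):

* `self_le_two_pow_qp`, `log_le_of_le_poly`, `qp_absorb` — bookkeeping: a polynomial blow-up
  `y ≤ c (n+1)^c (x+1)^c` of the size and one extra permanent factor are absorbed by enlarging `k`.
* `homogeneousComponent_perPoly_mul` — `(per_n · h)_{n+d} = per_n · h_d` (the permanent is a form).
* `exists_bottom_slice` — **the bottom slice of a cofactor is free**: for `h ≠ 0` the lowest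
  homogeneous component `h♭ = h_{ord h}` satisfies `L(per_n · h♭) ≤ L(per_n · h)`, by the landed stub
  `stub_bottomComponentFree` (bottom weighted components cost nothing over `ℝ≥0`) at the
  total-degree weight.

Line lead prover-line-stmt-ValiantsHypothesis-15046-c1-0, cycle 2 (2026-08-16).  No definitions,
no named facts; Mathlib + tree only.
-/

noncomputable section

-- `Summit.ValiantsHypothesis.ValiantsHypothesis.…` is the tree's mandated single-conjunct layout
-- (Problem = Summit), so the duplicated namespace component is intended.
set_option linter.dupNamespace false

namespace Summit.ValiantsHypothesis.ValiantsHypothesis.Theorems.DivisionGap.PerCofactorDegreeReduction.Window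

open MvPolynomial Literature.Computability.AlgebraicComplexity
open Summit.ValiantsHypothesis.Theorems.PerCofactorDegreeReductionNegative (lt_two_pow_qp qp_mono)
open scoped NNReal BigOperators

/-! ### Arithmetic of the quasi-polynomial bound -/

/-- `x ≤ 2 ^ ((a + log₂ x + k) ^ k)` for `k ≥ 1`. [folklore] -/
theorem self_le_two_pow_qp (x a k : ℕ) (hk : 1 ≤ k) : x ≤ 2 ^ ((a + Nat.log 2 x + k) ^ k) := by
  have h := lt_two_pow_qp x a k hk
  rw [Nat.add_comm (Nat.log 2 x) a] at h
  exact h.le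

/-- `log₂` of a product bound: `y ≤ c (n+1)^c (x+1)^c ⇒ log₂ y ≤ (c+1)(log₂ n + log₂ x) + 4c`.
[folklore] -/
theorem log_le_of_le_poly {c n x y : ℕ} (hy : y ≤ c * (n + 1) ^ c * (x + 1) ^ c) :
    Nat.log 2 y ≤ (c + 1) * (Nat.log 2 n + Nat.log 2 x + 1) + 3 * c := by
  rcases Nat.eq_zero_or_pos y with rfl | hy0
  · simp
  have hc0 : 0 < c := by
    rcases Nat.eq_zero_or_pos c with rfl | h
    · simp at hy; omega
    · exact h
  -- `n + 1 ≤ 2^(log n + 1)`, `x + 1 ≤ 2^(log x + 1)`, `c ≤ 2^c`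
  have hn : n + 1 ≤ 2 ^ (Nat.log 2 n + 1) := Nat.lt_pow_succ_log_self one_lt_two n
  have hx : x + 1 ≤ 2 ^ (Nat.log 2 x + 1) := Nat.lt_pow_succ_log_self one_lt_two x
  have hc : c ≤ 2 ^ c := Nat.lt_two_pow_self.le
  have hbound : y ≤ 2 ^ (c + c * (Nat.log 2 n + 1) + c * (Nat.log 2 x + 1)) := by
    calc y ≤ c * (n + 1) ^ c * (x + 1) ^ c := hy
      _ ≤ 2 ^ c * (2 ^ (Nat.log 2 n + 1)) ^ c * (2 ^ (Nat.log 2 x + 1)) ^ c := by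
          gcongr
      _ = 2 ^ (c + c * (Nat.log 2 n + 1) + c * (Nat.log 2 x + 1)) := by
          rw [← pow_mul, ← pow_mul, ← pow_add, ← pow_add]; ring_nf
  have hlog := Nat.log_mono_right (b := 2) hbound
  rw [Nat.log_pow one_lt_two] at hlog
  have : c + c * (Nat.log 2 n + 1) + c * (Nat.log 2 x + 1) ≤
      (c + 1) * (Nat.log 2 n + Nat.log 2 x + 1) + 3 * c := by nlinarith
  omega

/-- **Quasi-polynomial absorption**: a polynomial blow-up `y ≤ c (n+1)^c (x+1)^c` of the size and one
extra permanent factor are absorbed by enlarging `k`: there is `K ≥ 1` with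
`2^((log₂ n + log₂ y + k)^k) + n ≤ 2^((log₂ n + log₂ x + K)^K)` and
`c (n+1)^c (x+1)^c ≤ 2^((log₂ n + log₂ x + K)^K)`. [folklore] -/
theorem qp_absorb (c k : ℕ) : ∃ K : ℕ, 1 ≤ K ∧ ∀ n x y : ℕ, y ≤ c * (n + 1) ^ c * (x + 1) ^ c →
    2 ^ ((Nat.log 2 n + Nat.log 2 y + k) ^ k) + n ≤ 2 ^ ((Nat.log 2 n + Nat.log 2 x + K) ^ K) ∧
    c * (n + 1) ^ c * (x + 1) ^ c ≤ 2 ^ ((Nat.log 2 n + Nat.log 2 x + K) ^ K) := by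
  -- `E := (c+2)(a+1) + 4c + k` dominates both exponents, `a = log n + log x`
  set K := 4 * c + 2 * k + 4 with hK
  refine ⟨K, by omega, fun n x y hy => ?_⟩
  set a := Nat.log 2 n + Nat.log 2 x with ha
  have hlogy := log_le_of_le_poly hy
  have hK1 : 1 ≤ K := by omega
  -- the base `a + K` dominates the linear forms
  have hlin : Nat.log 2 n + Nat.log 2 y + k ≤ (c + 2) * (a + K) := by
    have : Nat.log 2 n ≤ a := Nat.le_add_right _ _
    nlinarith
  have hpow : (Nat.log 2 n + Nat.log 2 y + k) ^ k ≤ ((c + 2) * (a + K)) ^ k :=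
    Nat.pow_le_pow_left hlin k
  have hcK : c + 2 ≤ a + K := by omega
  have hpow2 : ((c + 2) * (a + K)) ^ k ≤ (a + K) ^ (2 * k) := by
    rw [mul_pow, two_mul, pow_add]
    exact Nat.mul_le_mul_right _ (Nat.pow_le_pow_left hcK k)
  have haK : 1 ≤ a + K := by omega
  have hE : (a + K) ^ (2 * k) + (a + 2) ≤ (a + K) ^ K := by
    have h1 : (a + K) ^ (2 * k) * (a + K) ^ 2 ≤ (a + K) ^ K := by
      rw [← pow_add]; exact Nat.pow_le_pow_right haK (by omega)
    have h2 : 1 ≤ (a + K) ^ (2 * k) := Nat.one_le_pow _ _ haK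
    have h3 : a + 2 + 1 ≤ (a + K) ^ 2 := by nlinarith
    nlinarith
  have hn : n ≤ 2 ^ (a + 1) := by
    have := (Nat.lt_pow_succ_log_self one_lt_two n).le
    exact this.trans (Nat.pow_le_pow_right two_pos (by omega))
  constructor
  · calc 2 ^ ((Nat.log 2 n + Nat.log 2 y + k) ^ k) + n
        ≤ 2 ^ ((a + K) ^ (2 * k)) + 2 ^ (a + 1) :=
          Nat.add_le_add (Nat.pow_le_pow_right two_pos (hpow.trans hpow2)) hn
      _ ≤ 2 ^ ((a + K) ^ (2 * k) + (a + 1)) := by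
          rw [pow_add (2 : ℕ) ((a + K) ^ (2 * k)) (a + 1)]
          have h1 : 2 ≤ 2 ^ ((a + K) ^ (2 * k)) := by
            calc (2:ℕ) = 2 ^ 1 := by norm_num
              _ ≤ 2 ^ ((a + K) ^ (2 * k)) :=
                Nat.pow_le_pow_right two_pos (Nat.one_le_pow _ _ haK)
          have h2 : 2 ≤ 2 ^ (a + 1) := by
            calc (2:ℕ) = 2 ^ 1 := by norm_num
              _ ≤ 2 ^ (a + 1) := Nat.pow_le_pow_right two_pos (by omega)
          nlinarith [Nat.mul_le_mul h1 (le_refl (2 ^ (a + 1))),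
            Nat.mul_le_mul (le_refl (2 ^ ((a + K) ^ (2 * k)))) h2]
      _ ≤ 2 ^ ((a + K) ^ K) := Nat.pow_le_pow_right two_pos (by omega)
  · have hlogc : c * (n + 1) ^ c * (x + 1) ^ c ≤
        2 ^ (c + c * (Nat.log 2 n + 1) + c * (Nat.log 2 x + 1)) := by
      have hn' : n + 1 ≤ 2 ^ (Nat.log 2 n + 1) := Nat.lt_pow_succ_log_self one_lt_two n
      have hx' : x + 1 ≤ 2 ^ (Nat.log 2 x + 1) := Nat.lt_pow_succ_log_self one_lt_two x
      have hc' : c ≤ 2 ^ c := Nat.lt_two_pow_self.le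
      calc c * (n + 1) ^ c * (x + 1) ^ c
          ≤ 2 ^ c * (2 ^ (Nat.log 2 n + 1)) ^ c * (2 ^ (Nat.log 2 x + 1)) ^ c := by gcongr
        _ = 2 ^ (c + c * (Nat.log 2 n + 1) + c * (Nat.log 2 x + 1)) := by
            rw [← pow_mul, ← pow_mul, ← pow_add, ← pow_add]; ring_nf
    refine hlogc.trans (Nat.pow_le_pow_right two_pos ?_)
    have h1 : c + c * (Nat.log 2 n + 1) + c * (Nat.log 2 x + 1) ≤ (c + 2) * (a + K) := by
      nlinarith
    calc c + c * (Nat.log 2 n + 1) + c * (Nat.log 2 x + 1) ≤ (c + 2) * (a + K) := h1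
      _ ≤ (a + K) * (a + K) := Nat.mul_le_mul_right _ hcK
      _ = (a + K) ^ 2 := (sq _).symm
      _ ≤ (a + K) ^ K := Nat.pow_le_pow_right haK (by omega)

/-! ### The bottom slice of a cofactor -/

/-- Homogeneous components of a multiple of the permanent: `(per_n · h)_{n+d} = per_n · h_d`.
[folklore] -/
theorem homogeneousComponent_perPoly_mul {n : ℕ} (d : ℕ) (h : MvPolynomial (Fin n × Fin n) ℝ≥0) :
    homogeneousComponent (n + d) (perPoly (Fin n) ℝ≥0 * h) =
      perPoly (Fin n) ℝ≥0 * homogeneousComponent d h := by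
  classical
  have hper : (perPoly (Fin n) ℝ≥0).IsHomogeneous n := by
    simpa using (perPoly_isHomogeneous (n := Fin n) (k := ℝ≥0))
  conv_lhs => rw [← sum_homogeneousComponent h, Finset.mul_sum, map_sum]
  have hterm : ∀ i, homogeneousComponent (n + d) (perPoly (Fin n) ℝ≥0 * homogeneousComponent i h) =
      if i = d then perPoly (Fin n) ℝ≥0 * homogeneousComponent d h else 0 := by
    intro i
    have hhom : (perPoly (Fin n) ℝ≥0 * homogeneousComponent i h) ∈
        homogeneousSubmodule (Fin n × Fin n) ℝ≥0 (n + i) :=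
      (mem_homogeneousSubmodule _ _).2 (hper.mul (homogeneousComponent_isHomogeneous i h))
    rw [homogeneousComponent_of_mem hhom]
    by_cases hi : i = d
    · subst hi; simp
    · rw [if_neg (by omega), if_neg hi]
  simp_rw [hterm]
  rw [Finset.sum_ite_eq']
  split_ifs with hd
  · rfl
  · rw [homogeneousComponent_eq_zero]
    · rw [mul_zero]
    · rw [Finset.mem_range] at hd; omega

/-- Monomials of `per_n · h` have degree `≥ n + d` when all monomials of `h` have degree `≥ d`.
[folklore] -/
theorem le_weight_of_mem_support_perPoly_mul {n : ℕ} {d : ℕ} {h : MvPolynomial (Fin n × Fin n) ℝ≥0}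
    (hd : ∀ m ∈ h.support, d ≤ m.degree) :
    ∀ m ∈ (perPoly (Fin n) ℝ≥0 * h).support, n + d ≤ Finsupp.weight (1 : Fin n × Fin n → ℕ) m := by
  classical
  intro m hm
  have hper : (perPoly (Fin n) ℝ≥0).IsHomogeneous n := by
    simpa using (perPoly_isHomogeneous (n := Fin n) (k := ℝ≥0))
  obtain ⟨a, ha, b, hb, rfl⟩ := Finset.mem_add.1 (support_mul _ _ hm)
  have ha' : Finsupp.weight (1 : Fin n × Fin n → ℕ) a = n := hper (mem_support_iff.1 ha)
  have hb' : d ≤ Finsupp.weight (1 : Fin n × Fin n → ℕ) b := by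
    have := hd b hb
    rwa [Finsupp.degree_eq_weight_one] at this
  rw [map_add, ha']
  omega

/-- **The bottom slice of a cofactor is free**: for `h ≠ 0` there is a nonzero homogeneous slice
`h♭ = h_{ord h}` (all monomials of `h` have degree `≥ ord h = deg h♭`) with
`L(per_n · h♭) ≤ L(per_n · h)` (`stub_bottomComponentFree` at the total-degree weight). [folklore] -/
theorem exists_bottom_slice {n : ℕ} (h : MvPolynomial (Fin n × Fin n) ℝ≥0) (hh : h ≠ 0) :
    ∃ (d : ℕ) (hb : MvPolynomial (Fin n × Fin n) ℝ≥0), hb ≠ 0 ∧ hb.IsHomogeneous d ∧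
      hb.support ⊆ h.support ∧ hb.totalDegree = d ∧
      complexity (perPoly (Fin n) ℝ≥0 * hb) ≤ complexity (perPoly (Fin n) ℝ≥0 * h) := by
  classical
  obtain ⟨m₀, hm₀, hmin⟩ := Finset.exists_min_image h.support Finsupp.degree
    (support_nonempty.2 hh)
  have hb0 : homogeneousComponent m₀.degree h ≠ 0 := by
    intro h0
    have := congr_arg (coeff m₀) h0
    rw [coeff_homogeneousComponent, if_pos rfl, coeff_zero] at this
    exact (mem_support_iff.1 hm₀) this
  refine ⟨m₀.degree, homogeneousComponent m₀.degree h, hb0, homogeneousComponent_isHomogeneous _ _,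
    ?_, (homogeneousComponent_isHomogeneous _ _).totalDegree hb0, ?_⟩
  · intro m hm
    rw [mem_support_iff, coeff_homogeneousComponent] at hm
    split_ifs at hm with h1
    · exact mem_support_iff.2 hm
    · exact absurd rfl hm
  · rw [← homogeneousComponent_perPoly_mul]
    exact Summit.ValiantsHypothesis.ValiantsHypothesis.Theorems.DivisionGap.PerCofactorDegreeReduction.BottomComponentFree.stub_bottomComponentFree
      1 _ _ (le_weight_of_mem_support_perPoly_mul hmin)

/-! ### Appendix (cycle 2, part 3 glue): lifting nonnegative real polynomials to `ℝ≥0[x]`, quasi-polynomial glue -/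

/-- `toReal : ℝ≥0 →+* ℝ` is injective. [folklore] -/
theorem toRealHom_injective : Function.Injective (NNReal.toRealHom : ℝ≥0 → ℝ) :=
  fun a b h => NNReal.coe_injective (by simpa using h)

/-- `map toReal` is injective on `ℝ≥0[x]`. [folklore] -/
theorem map_toRealHom_injective {σ : Type*} :
    Function.Injective
      (MvPolynomial.map NNReal.toRealHom : MvPolynomial σ ℝ≥0 → MvPolynomial σ ℝ) :=
  map_injective _ toRealHom_injective

/-- `map toReal` preserves the total degree. [folklore] -/
theorem totalDegree_map_toRealHom {σ : Type*} (p : MvPolynomial σ ℝ≥0) :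
    (MvPolynomial.map NNReal.toRealHom p).totalDegree = p.totalDegree := by
  simp only [totalDegree, support_map_of_injective p (f := NNReal.toRealHom) toRealHom_injective]

/-- A real polynomial with nonnegative coefficients lifts to `ℝ≥0[x]`. [folklore] -/
theorem exists_lift_of_coeff_nonneg {σ : Type*} (q : MvPolynomial σ ℝ)
    (hq : ∀ m, 0 ≤ coeff m q) :
    ∃ p : MvPolynomial σ ℝ≥0, MvPolynomial.map NNReal.toRealHom p = q := by
  have h : q ∈ Set.range (MvPolynomial.map NNReal.toRealHom (σ := σ)) := by
    rw [mem_range_map_iff_coeffs_subset]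
    intro c hc
    obtain ⟨m, -, rfl⟩ := mem_coeffs_iff.mp (Finset.mem_coe.mp hc)
    exact ⟨⟨coeff m q, hq m⟩, rfl⟩
  obtain ⟨p, hp⟩ := h
  exact ⟨p, hp⟩

/-- Coefficients of `map toReal A` are nonnegative. [folklore] -/
theorem coeff_map_toRealHom_nonneg {σ : Type*} (A : MvPolynomial σ ℝ≥0) (m : σ →₀ ℕ) :
    0 ≤ coeff m (MvPolynomial.map NNReal.toRealHom A) := by
  rw [coeff_map]
  exact (coeff m A).2

/-- **Quasi-polynomial glue**: for all `k₁, k₂` there is `K` such that for all `a` and all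
`l₁ ≤ a`, `l₂, l₃ ≤ (a + k₁)^k₁`:
`2^((a+k₁)^k₁) + 2^((l₁+l₂+l₃+k₂)^k₂) + 1 ≤ 2^((a+K)^K)` (polylog ∘ polylog = polylog). [folklore] -/
theorem qp_glue (k₁ k₂ : ℕ) : ∃ K : ℕ, ∀ a l₁ l₂ l₃ : ℕ, l₁ ≤ a → l₂ ≤ (a + k₁) ^ k₁ →
    l₃ ≤ (a + k₁) ^ k₁ →
    2 ^ ((a + k₁) ^ k₁) + 2 ^ ((l₁ + l₂ + l₃ + k₂) ^ k₂) + 1 ≤ 2 ^ ((a + K) ^ K) := by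
  set c := k₁ + k₂ + 2 with hc
  set c' := (c + 2) * (k₂ + 1) with hc'
  refine ⟨c' + 1, fun a l₁ l₂ l₃ h₁ h₂ h₃ => ?_⟩
  set K := c' + 1 with hK
  have hc2 : 2 ≤ c := by omega
  have hcc' : c ≤ c' := by
    have : c + 2 ≤ (c + 2) * (k₂ + 1) := Nat.le_mul_of_pos_right _ (Nat.succ_pos _)
    omega
  have hac1 : 1 ≤ a + c := by omega
  have haK : a + c ≤ a + K := by omega
  -- `(a+k₁)^k₁ ≤ (a+c)^c`
  have hE1 : (a + k₁) ^ k₁ ≤ (a + c) ^ c :=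
    calc (a + k₁) ^ k₁ ≤ (a + c) ^ k₁ := Nat.pow_le_pow_left (by omega) _
      _ ≤ (a + c) ^ c := Nat.pow_le_pow_right hac1 (by omega)
  have hself : a + c ≤ (a + c) ^ c := Nat.le_self_pow (by omega) _
  -- the base of the second exponent
  have hbase : l₁ + l₂ + l₃ + k₂ ≤ (a + c) ^ (c + 2) := by
    have h4 : l₁ + l₂ + l₃ + k₂ ≤ 4 * (a + c) ^ c := by omega
    have hsq : 4 ≤ (a + c) ^ 2 := by nlinarith
    calc l₁ + l₂ + l₃ + k₂ ≤ 4 * (a + c) ^ c := h4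
      _ ≤ (a + c) ^ 2 * (a + c) ^ c := Nat.mul_le_mul_right _ hsq
      _ = (a + c) ^ (c + 2) := by rw [← pow_add]; ring_nf
  set Y := (a + K) ^ c' with hY
  have hY1 : (a + k₁) ^ k₁ ≤ Y :=
    calc (a + k₁) ^ k₁ ≤ (a + c) ^ c := hE1
      _ ≤ (a + K) ^ c := Nat.pow_le_pow_left haK _
      _ ≤ (a + K) ^ c' := Nat.pow_le_pow_right (by omega) hcc'
  have hY2 : (l₁ + l₂ + l₃ + k₂) ^ k₂ ≤ Y :=
    calc (l₁ + l₂ + l₃ + k₂) ^ k₂ ≤ ((a + c) ^ (c + 2)) ^ k₂ := Nat.pow_le_pow_left hbase _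
      _ = (a + c) ^ ((c + 2) * k₂) := by rw [← pow_mul]
      _ ≤ (a + K) ^ ((c + 2) * k₂) := Nat.pow_le_pow_left haK _
      _ ≤ (a + K) ^ c' := Nat.pow_le_pow_right (by omega)
          (by rw [hc']; exact Nat.mul_le_mul_left _ (Nat.le_succ _))
  have hYpos : 1 ≤ Y := Nat.one_le_pow _ _ (by omega)
  have hYK : Y + 2 ≤ (a + K) ^ K := by
    have h1 : (a + K) ^ K = Y * (a + K) := by rw [hY, hK, pow_succ]
    rw [h1]
    have h3 : 3 ≤ a + K := by omega
    nlinarith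
  calc 2 ^ ((a + k₁) ^ k₁) + 2 ^ ((l₁ + l₂ + l₃ + k₂) ^ k₂) + 1
      ≤ 2 ^ Y + 2 ^ Y + 2 ^ Y := by
        apply Nat.add_le_add (Nat.add_le_add ?_ ?_) Nat.one_le_two_pow
        · exact Nat.pow_le_pow_right two_pos hY1
        · exact Nat.pow_le_pow_right two_pos hY2
    _ ≤ 2 ^ (Y + 2) := by rw [pow_add]; omega
    _ ≤ 2 ^ ((a + K) ^ K) := Nat.pow_le_pow_right two_pos hYK

end Summit.ValiantsHypothesis.ValiantsHypothesis.Theorems.DivisionGap.PerCofactorDegreeReduction.Window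

end
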